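import Literature.NumberTheory.EllipticCurves.CasselsTateThetaEven
import Literature.NumberTheory.EllipticCurves.CasselsTateGeneralCaseLocal
import Literature.NumberTheory.EllipticCurves.LocalKummerIsotropyTransport
import Literature.NumberTheory.EllipticCurves.KummerImageIsotropyProofs
import Literature.NumberTheory.EllipticCurves.PoonenRainsKummerChords
import Literature.NumberTheory.GaloisRepresentations.GaloisCohomologyProofs
import HarnessLib

/-!
# Local isotropy of the even theta group: Kummer lifts along `[2]` have principal obstruction cocycle

Topic `NumberTheory/EllipticCurves`; namespace `Literature.NumberTheory.EllipticCurves`.  Theorems and one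
auxiliary general lemma: **no named fact is introduced** (D-0026).

For the `μ_{m²}`-valued theta group `thetaEven W m P …` of `CasselsTateThetaEven` (Morgan–Smith's
`𝓗(E[m²])`, Def. 5.19, normalised by the Arf form) this file proves the field `iso` of
`LevelThetaDatum` (`CasselsTateSelfPairingLevel`): at every place `v` of the number field `K`, every local
Kummer cocycle `κ` of level `m²` (class in `𝓛_v^{(m²)}`) lifts along `[2] : E[2m²] → E[m²]` to a local
Kummer cocycle `κ̃` of level `2m²` (`exists_kummerLift_two`, Milne's choice of lifts as in
`exists_kummerLift`), and the obstruction (Zarhin / Poonen–Rains) cocycle of `κ̃` in the theta group is a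
CONTINUOUS COBOUNDARY of `μ_{m²}` (`thetaEven_iso`).  Proof: in `K̄ˣ`,
`conn κ̃ (σ,τ) = ∂(η ∘ κ̃)(σ,τ) · P(κ̃σ, σκ̃τ)`; the cup-product cocycle `P(κ̃σ, σκ̃τ)` of the Kummer class
at level `2m²` is a coboundary `∂θ` in `μ_{2m²}` by the isotropy of the local Kummer condition
(`kummerClass_cupProduct_kummerClass_eq_zero_holds`, Poonen–Rains Prop. 4.8); so `conn κ̃ = ∂u` with
`u = (η ∘ κ̃) · θ ∈ K̄ˣ` locally constant, and a `μ_{m²}`-valued primitive is obtained by Hilbert 90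
(`exists_mu_coboundary_of_coboundary`, the normalisation step of `KummerImageIsotropyProofs.exists_mu_coboundary`
in abstract form: `uⁿ` is a locally constant `K̄ˣ`-cocycle, `= σλ/λ`, and `u λ₁/σλ₁`, `λ₁ⁿ = λ`, works).

References: [MorganSmith2021CTP] §5 Def. 5.3 (isotropy of local conditions), Example 5.20; [PoonenRains2012]
Prop. 4.8; J.-P. Serre, *Local Fields*, X §1 Prop. 2 (Hilbert 90) [Serre1979]; [MilneADT2006] I §6 Prop. 6.9.
-/

noncomputable section

open scoped Classical

universe u

namespace Literature.NumberTheory.EllipticCurves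

open _root_.WeierstrassCurve Field Function NumberField
open Literature.NumberTheory.GaloisRepresentations Literature.NumberTheory.GaloisCohomology
open Literature.NumberTheory.GaloisRepresentations.DiscreteGaloisModule (mu MuCarrier pairing)
open Literature.Algebra.Homology Literature.GroupTheory.FiniteAbelian
open scoped ContRepresentation

-- Cup products need `LocallyCompactSpace Γ`; as in the tree's cup-product files, the compactness of
-- absolute Galois groups is a local instance only.
attribute [local instance] absoluteGaloisGroup_compactSpace

-- `char K_v = 0` for the completions of a number field (the tree's theorem `charZero_placeCompletion`;
-- local instance, no override).
attribute [local instance] charZero_placeCompletion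

/-! ### Hilbert 90: `μₙ`-valued primitives of `μₙ`-valued coboundaries of locally constant `K̄ˣ`-cochains -/

section H90

variable {F : Type u} [Field F]

/-- **Hilbert 90 normalisation.**  Let `u : Γ_F → F̄ˣ` be locally constant with coboundary
`c(σ,τ) = u σ · σu τ / u(στ)` valued in `μₙ` (`c(σ,τ)ⁿ = 1`).  Then `c = ∂b` for a locally constant
`μₙ`-VALUED `b`: `uⁿ` is a locally constant `1`-cocycle of `F̄ˣ`, hence `uⁿ σ = σλ/λ` (Hilbert 90,
`AlgEquiv.exists_smul_div_eq_of_isOpen`), and `b = u λ₁/σλ₁` with `λ₁ⁿ = λ` works (the normalisation step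
of `KummerImageIsotropyProofs.exists_mu_coboundary`, abstracted). [cite: Serre1979, Ch. X §1, Prop. 2] -/
theorem exists_mu_coboundary_of_coboundary {n : ℕ} (hn : n ≠ 0) (u : absoluteGaloisGroup F → AlgebraicClosure F)
    (hu0 : ∀ σ, u σ ≠ 0) (hulc : IsLocallyConstant u) (c : absoluteGaloisGroup F → absoluteGaloisGroup F → AlgebraicClosure F)
    (hI : ∀ σ τ, c σ τ * u (σ * τ) = u σ * σ • u τ) (hcpow : ∀ σ τ, c σ τ ^ n = 1) :
    ∃ b : absoluteGaloisGroup F → AlgebraicClosure F, IsLocallyConstant b ∧ (∀ σ, b σ ^ n = 1) ∧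
      ∀ σ τ, c σ τ * b (σ * τ) = b σ * σ • b τ := by
  let Φ : AlgebraicClosure F → (AlgebraicClosure F)ˣ := fun a => if ha : a = 0 then 1 else Units.mk0 a ha ^ n
  set f : absoluteGaloisGroup F → (AlgebraicClosure F)ˣ := fun ρ => Φ (u ρ) with hf
  have hfval : ∀ ρ, ((f ρ : (AlgebraicClosure F)ˣ) : AlgebraicClosure F) = u ρ ^ n := fun ρ => by
    simp only [hf, Φ, dif_neg (hu0 ρ), Units.val_pow_eq_pow_val, Units.val_mk0]
  have hflc : IsLocallyConstant f := hulc.comp Φ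
  have hsm : ∀ (g : absoluteGaloisGroup F) (z : (AlgebraicClosure F)ˣ),
      ((g • z : (AlgebraicClosure F)ˣ) : AlgebraicClosure F) = g • (z : AlgebraicClosure F) := fun g z => rfl
  have hfcoc : ∀ g h : absoluteGaloisGroup F, f (g * h) = g • f h * f g := by
    intro g h
    apply Units.ext
    rw [Units.val_mul, hsm, hfval, hfval, hfval, smul_pow']
    have e := congrArg (fun z => z ^ n) (hI g h)
    simp only [mul_pow, hcpow, one_mul] at e
    rw [e, mul_comm]
  have hopen : IsOpen {g : absoluteGaloisGroup F | f g = 1} := hflc.isOpen_fiber 1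
  obtain ⟨x, hx⟩ := Literature.NumberTheory.GaloisRepresentations.AlgEquiv.exists_smul_div_eq_of_isOpen
    (K := F) (L := AlgebraicClosure F) f hfcoc hopen
  have hxval : ∀ g : absoluteGaloisGroup F,
      g • ((x : (AlgebraicClosure F)ˣ) : AlgebraicClosure F) / x = u g ^ n := fun g => by
    have e := congrArg (fun z : (AlgebraicClosure F)ˣ => (z : AlgebraicClosure F)) (hx g)
    simp only [Units.val_div_eq_div_val, hfval] at e
    rw [← e, AlgEquiv.smul_units_def, Units.coe_map, MonoidHom.coe_coe]
    rfl
  have hx0 : ((x : (AlgebraicClosure F)ˣ) : AlgebraicClosure F) ≠ 0 := x.ne_zero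
  obtain ⟨y, hy⟩ := IsAlgClosed.exists_pow_nat_eq ((x : (AlgebraicClosure F)ˣ) : AlgebraicClosure F)
    (Nat.pos_of_ne_zero hn)
  have hy0 : y ≠ 0 := fun h0 => hx0 (by rw [← hy, h0, zero_pow hn])
  have hgy0 : ∀ g : absoluteGaloisGroup F, g • y ≠ 0 := fun g h0 => hy0 (by
    rw [smul_eq_zero_iff_eq] at h0
    exact h0)
  have hgx0 : ∀ g : absoluteGaloisGroup F, g • ((x : (AlgebraicClosure F)ˣ) : AlgebraicClosure F) ≠ 0 :=
    fun g h0 => hx0 (by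
      rw [smul_eq_zero_iff_eq] at h0
      exact h0)
  refine ⟨fun g => u g * y / g • y, ?_, fun g => ?_, fun g h => ?_⟩
  · exact (hulc.prodMk (WeierstrassCurve.isLocallyConstant_smul_algebraicClosure y)).comp fun p : AlgebraicClosure F × AlgebraicClosure F =>
      p.1 * y / p.2
  · have hxg := hxval g
    have hgx := hgx0 g
    rw [div_pow, mul_pow, ← smul_pow', hy, ← hxval g]
    field_simp
  · have e := hI g h
    have hgy := hgy0 g
    have hghy : g • h • y ≠ 0 := by rw [← mul_smul]; exact hgy0 (g * h)
    beta_reduce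
    rw [mul_smul]
    have h1 : g • (u h * y / h • y) = g • u h * g • y / g • h • y := by
      rw [div_eq_mul_inv, div_eq_mul_inv, smul_mul', smul_mul', smul_inv'']
    rw [h1]
    calc c g h * (u (g * h) * y / g • h • y)
          = (c g h * u (g * h)) * y / g • h • y := by ring
      _ = u g * g • u h * y / g • h • y := by rw [e]
      _ = u g * g • u h * y * g • y / (g • h • y * g • y) := (mul_div_mul_right _ _ hgy).symm
      _ = u g * y / g • y * (g • u h * g • y / g • h • y) := by
          rw [div_mul_div_comm]; ring

end H90

/-! ### Kummer lifts along `[2] : E[2m²] → E[m²]` -/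

section Lift

variable {K : Type u} [Field K] [CharZero K] (W : WeierstrassCurve K) [W.IsElliptic] (m : ℕ) [NeZero m]
variable (E : Type u) [Field E] [Algebra K E]

/-- **Local Kummer lifts along `[2]` with prescribed values**: for a cocycle `ψ : Γ_E → E[m²](K̄)` whose class
lies in `𝓛_E^{(m²)}` there is a point `Q₂ ∈ E(K̄_E)` with `2m² Q₂ ∈ E(E)` whose Kummer cocycle `κ̃ = κ_{Q₂}` of
level `2m²` satisfies `[2] ∘ κ̃ = ψ` exactly (write `ψ = κ_Q`, `Q = 2 Q₂`; as `exists_kummerLift`).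
[cite: MilneADT2006, Ch. I §6, proof of Prop. 6.9 (the local Kummer lifts b_{v,1})] -/
theorem exists_kummerLift_two
    (ψ : contOneCocycles (torsionRepAt W E ((m * m : ℕ) : ℤ)))
    (hψ : locClass (W.torsionGaloisModule ((m * m : ℕ) : ℤ)) E ψ ∈ W.kummerLocalConditionAt ((m * m : ℕ) : ℤ) E) :
    ∃ (Q₂ : localPoints W E)
      (hQ₂ : ((2 * (m * m) : ℕ) : ℤ) • Q₂ ∈ MulAction.fixedPoints (absoluteGaloisGroup E) (localPoints W E)),
      ∀ σ, mulK W 2 (m * m)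
          ((W.localKummerCocycle _ (Int.natCast_ne_zero.mpr (Nat.mul_ne_zero two_ne_zero
            (Nat.mul_ne_zero (NeZero.ne m) (NeZero.ne m)))) Q₂ hQ₂).1 σ) = ψ.1 σ := by
  have hmm : ((m * m : ℕ) : ℤ) ≠ 0 := Int.natCast_ne_zero.mpr (Nat.mul_ne_zero (NeZero.ne m) (NeZero.ne m))
  have h2 : (2 : ℤ) ≠ 0 := two_ne_zero
  obtain ⟨Q, hQ, rfl⟩ := exists_localKummerCocycle_eq W E hmm ψ hψ
  obtain ⟨Q₂, hQ₂⟩ : ∃ Q₂ : localPoints W E, (2 : ℤ) • Q₂ = Q :=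
    (W.baseChange (AlgebraicClosure E)).zsmul_surjective_of_isAlgClosed h2 Q
  have hfix : ((2 * (m * m) : ℕ) : ℤ) • Q₂ ∈ MulAction.fixedPoints (absoluteGaloisGroup E) (localPoints W E) := by
    rw [Nat.cast_mul, mul_comm, mul_zsmul, Nat.cast_ofNat, hQ₂]
    exact hQ
  refine ⟨Q₂, hfix, fun σ => ?_⟩
  have h := (W.torsionPointsEquiv_symm_zsmul (2 : ℤ) ((m * m : ℕ) : ℤ) (mul_ne_zero h2 hmm) hmm
    ⟨σ • Q₂ - Q₂, smul_sub_mem_torsionBy_localPoints hfix σ⟩).symm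
  refine h.trans ?_
  change (W.torsionPointsEquiv ((m * m : ℕ) : ℤ) (E := E) hmm).symm _ =
    (W.torsionPointsEquiv ((m * m : ℕ) : ℤ) (E := E) hmm).symm ⟨σ • Q - Q, _⟩
  congr 1
  apply Subtype.ext
  change (2 : ℤ) • (σ • Q₂ - Q₂) = σ • Q - Q
  rw [zsmul_sub, ← smul_zsmul_localPoints, hQ₂]

end Lift

/-! ### Transport of the Hilbert 90 normalisation to `Γ_E` acting on `K̄` through the restriction -/

section H90Res

variable {K : Type u} [Field K] [CharZero K] (E : Type u) [Field E] [Algebra K E]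

omit [CharZero K] in
/-- An `n`-th root of unity of `Ē` comes from `K̄` along the chosen embedding `ι : K̄ → Ē`
(`Xⁿ − 1` splits in `K̄`). [cite: SerreGaloisCohomology1997, II §1.2 (μₙ ⊂ K̄ˣ)] -/
theorem exists_closureEmb_eq_of_pow_eq_one {n : ℕ} (hn : n ≠ 0) {z : AlgebraicClosure E} (hz : z ^ n = 1) :
    ∃ w : AlgebraicClosure K, closureEmb (K := K) E w = z := by
  set f : Polynomial (AlgebraicClosure K) := Polynomial.X ^ n - Polynomial.C 1 with hf
  have hf0 : f ≠ 0 := Polynomial.X_pow_sub_C_ne_zero (Nat.pos_of_ne_zero hn) 1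
  have hroot : (f.map (closureEmb (K := K) E).toRingHom).IsRoot z := by
    rw [Polynomial.IsRoot, Polynomial.eval_map, hf]
    simp [hz]
  obtain ⟨w, hw⟩ := Polynomial.Splits.mem_range_of_isRoot (IsAlgClosed.splits f) hf0 hroot
  exact ⟨w, hw⟩

omit [CharZero K] in
/-- **Hilbert 90 normalisation for `Γ_E` acting on `K̄` through `res : Γ_E → Γ_K`**: a locally constant
`u : Γ_E → K̄ˣ` whose twisted coboundary `c(σ,τ) = uσ · (res σ)uτ / u(στ)` is `μₙ`-valued has `c = ∂b` for a
locally constant `μₙ(K̄)`-valued `b` (transport `exists_mu_coboundary_of_coboundary` along `ι : K̄ → Ē`).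
[cite: Serre1979, Ch. X §1, Prop. 2] -/
theorem exists_mu_coboundary_of_coboundary_res {n : ℕ} (hn : n ≠ 0)
    (u : absoluteGaloisGroup E → AlgebraicClosure K) (hu0 : ∀ σ, u σ ≠ 0) (hulc : IsLocallyConstant u)
    (c : absoluteGaloisGroup E → absoluteGaloisGroup E → AlgebraicClosure K)
    (hI : ∀ σ τ, c σ τ * u (σ * τ) = u σ * absGaloisRestrict K E σ • u τ) (hcpow : ∀ σ τ, c σ τ ^ n = 1) :
    ∃ b : absoluteGaloisGroup E → AlgebraicClosure K, IsLocallyConstant b ∧ (∀ σ, b σ ^ n = 1) ∧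
      ∀ σ τ, c σ τ * b (σ * τ) = b σ * absGaloisRestrict K E σ • b τ := by
  set ι := closureEmb (K := K) E with hι
  have hinj : Function.Injective ι := RingHom.injective ι.toRingHom
  obtain ⟨b', hb'lc, hb'pow, hb'⟩ := exists_mu_coboundary_of_coboundary (F := E) hn (fun σ => ι (u σ))
    (fun σ h0 => hu0 σ (hinj (by rw [h0, map_zero]))) (hulc.comp ι) (fun σ τ => ι (c σ τ))
    (fun σ τ => by rw [← map_mul, hI, map_mul, ThetaLevelTwo.closureEmb_smul])
    (fun σ τ => by rw [← map_pow, hcpow, map_one])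
  -- pull `b'` back to `K̄`
  have hex : ∀ σ, ∃ w : AlgebraicClosure K, ι w = b' σ := fun σ =>
    exists_closureEmb_eq_of_pow_eq_one E hn (hb'pow σ)
  refine ⟨fun σ => (hex σ).choose, ?_, fun σ => ?_, fun σ τ => ?_⟩
  · refine (IsLocallyConstant.iff_exists_open _).2 fun σ₀ => ?_
    obtain ⟨U, hU, hσ₀, hconst⟩ := (IsLocallyConstant.iff_exists_open _).1 hb'lc σ₀
    refine ⟨U, hU, hσ₀, fun σ hσ => hinj ?_⟩
    rw [(hex σ).choose_spec, (hex σ₀).choose_spec, hconst σ hσ]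
  · apply hinj
    rw [map_pow, (hex σ).choose_spec, hb'pow, map_one]
  · apply hinj
    rw [map_mul, map_mul, (hex (σ * τ)).choose_spec, (hex σ).choose_spec, ThetaLevelTwo.closureEmb_smul,
      (hex τ).choose_spec]
    exact hb' σ τ

end H90Res

/-! ### The local isotropy of `thetaEven` -/

section Iso

variable {K : Type u} [Field K] [NumberField K] (W : WeierstrassCurve K) [W.IsElliptic] (m : ℕ) [NeZero m]
variable (P : geomTorsion W ((2 * (m * m) : ℕ) : ℤ) → geomTorsion W ((2 * (m * m) : ℕ) : ℤ) → AlgebraicClosure K)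
  (hP1 : ∀ x y, P x y ^ (2 * (m * m)) = 1)
  (hPadd₁ : ∀ x₁ x₂ y, P (x₁ + x₂) y = P x₁ y * P x₂ y)
  (hPadd₂ : ∀ x y₁ y₂, P x (y₁ + y₂) = P x y₁ * P x y₂)
  (hPalt : ∀ x, P x x = 1)
  (hPgal : ∀ (σ : absoluteGaloisGroup K) (x y : geomTorsion W ((2 * (m * m) : ℕ) : ℤ)),
    σ • P x y = P (σ • x) (σ • y))

include hP1 hPadd₁ hPadd₂ hPalt hPgal in
/-- **Local isotropy of the even theta group** (the field `iso` of `LevelThetaDatum` for `thetaEven`): at every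
place `v`, every local Kummer cocycle `κ` of level `m²` lifts along `[2]` to a local Kummer cocycle `κ̃` of level
`2m²` whose obstruction cocycle in `thetaEven` is a continuous coboundary of `μ_{m²}` — from the isotropy of the
Kummer image for the cup product at level `2m²` (Poonen–Rains Prop. 4.8, the tree's discharged fact
`kummerClass_cupProduct_kummerClass_eq_zero_holds`) and Hilbert 90. [cite: MorganSmith2021CTP, §5 Def. 5.3 and Example 5.20 (isotropy of the local conditions)] -/
theorem thetaEven_iso (v : Place K) (κ : contOneCocycles (torsionRepAt W (Place.Completion v) ((m * m : ℕ) : ℤ)))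
    (hκ : locClass (W.torsionGaloisModule ((m * m : ℕ) : ℤ)) (Place.Completion v) κ ∈
      W.kummerLocalConditionAt ((m * m : ℕ) : ℤ) (Place.Completion v)) :
    ∃ κl : contOneCocycles (torsionRepAt W (Place.Completion v) ((2 * (m * m) : ℕ) : ℤ)),
      (∀ σ, mulK W 2 (m * m) (κl.1 σ) = κ.1 σ) ∧
      ∃ b : C(absoluteGaloisGroup (Place.Completion v), muRepAt (K := K) m (Place.Completion v)),
        ∀ σ τ, ((thetaEven W m P hP1 hPadd₁ hPadd₂ hPalt hPgal).comap
              (absGaloisRestrict K (Place.Completion v) :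
                absoluteGaloisGroup (Place.Completion v) →ₜ* absoluteGaloisGroup K).toMonoidHom).conn
            (fun σ => κl.1 σ) σ τ =
          (mu K (m * m)).toTopRep.ρ (absGaloisRestrict K (Place.Completion v) σ) (b τ) - b (σ * τ) + b σ := by
  -- notation
  have hn : m * m ≠ 0 := Nat.mul_ne_zero (NeZero.ne m) (NeZero.ne m)
  have h2n : 2 * (m * m) ≠ 0 := Nat.mul_ne_zero two_ne_zero hn
  have h2nz : ((2 * (m * m) : ℕ) : ℤ) ≠ 0 := Int.natCast_ne_zero.mpr h2n
  -- the Kummer lift along `[2]`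
  obtain ⟨Q₂, hQ₂, hlift⟩ := exists_kummerLift_two W m (Place.Completion v) κ hκ
  set κl := W.localKummerCocycle _ (Int.natCast_ne_zero.mpr (Nat.mul_ne_zero two_ne_zero
    (Nat.mul_ne_zero (NeZero.ne m) (NeZero.ne m)))) Q₂ hQ₂ with hκl
  refine ⟨κl, hlift, ?_⟩
  have hκlmem : locClass (W.torsionGaloisModule ((2 * (m * m) : ℕ) : ℤ)) (Place.Completion v) κl ∈
      W.kummerLocalConditionAt ((2 * (m * m) : ℕ) : ℤ) (Place.Completion v) :=
    W.localKummerClass_mem_kummerLocalConditionAt _ _ Q₂ hQ₂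
  -- the cup-product class of `κ̃` with itself vanishes (isotropy of the Kummer image at level `2m²`)
  have hcup0 := W.cupProduct_eq_zero_of_mem_kummerLocalConditionAt_of_fact (2 * (m * m)) P h2nz
    (kummerClass_cupProduct_kummerClass_eq_zero_holds (Place.Completion v)) hP1 hPadd₁ hPadd₂ hPalt hPgal hκlmem hκlmem
  have hcup1 : twoCocycleClass _ ((((weilContPairing W (2 * (m * m)) P hP1 hPadd₁ hPadd₂ hPgal).restrict
      (absGaloisRestrict K (Place.Completion v))).cupCocycle κl κl)) = 0 := by
    rw [← ContPairing.cupProduct_oneCocycleClass_eq_twoCocycleClass]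
    exact hcup0
  obtain ⟨θ, hθ⟩ := (twoCocycleClass_eq_zero_iff _ _).mp hcup1
  -- its values in `K̄`: `P(κ̃σ, σκ̃τ) · θ(στ) = θσ · σθτ`
  have hκl2 : ∀ σ τ, κl.1 (σ * τ) - κl.1 σ = absGaloisRestrict K (Place.Completion v) σ • κl.1 τ := fun σ τ =>
    contOneCocycles.apply_mul_sub κl σ τ
  have hκl3 : ∀ σ τ, κl.1 σ + absGaloisRestrict K (Place.Completion v) σ • κl.1 τ = κl.1 (σ * τ) := fun σ τ => by
    rw [← hκl2]; abel
  -- values of `μ_N` in `K̄` through the tree's `GaloisRepresentations.muVal` (a unit of `K̄`)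
  have hvadd : ∀ {N : ℕ} (z z' : MuCarrier K N), (muVal K N (z + z') : AlgebraicClosure K) = muVal K N z * muVal K N z' :=
    fun z z' => by rw [muVal_add, Units.val_mul]
  have hvsub : ∀ {N : ℕ} (z z' : MuCarrier K N), (muVal K N (z - z') : AlgebraicClosure K) = muVal K N z / muVal K N z' :=
    fun z z' => by rw [muVal_sub, Units.val_div_eq_div_val]
  have hvmu : ∀ {N : ℕ} (σ' : absoluteGaloisGroup K) (z : MuCarrier K N),
      (muVal K N (mu K N σ' z) : AlgebraicClosure K) = σ' • (muVal K N z : AlgebraicClosure K) :=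
    fun σ' z => by rw [muVal_apply, Units.coe_smul]
  have hvpow : ∀ {N : ℕ} (z : MuCarrier K N), (muVal K N z : AlgebraicClosure K) ^ N = 1 := fun z => by
    rw [← Units.val_pow_eq_pow_val, muVal_pow_eq_one, Units.val_one]
  have hθval : ∀ σ τ, P (κl.1 σ) (absGaloisRestrict K (Place.Completion v) σ • κl.1 τ) *
      (muVal K _ (θ (σ * τ)) : AlgebraicClosure K) =
      (muVal K _ (θ σ) : AlgebraicClosure K) * absGaloisRestrict K (Place.Completion v) σ • (muVal K _ (θ τ) : AlgebraicClosure K) := by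
    intro σ τ
    have h := congrArg (fun z => (muVal K _ z : AlgebraicClosure K)) (hθ σ τ)
    simp only at h
    rw [ContPairing.cupCocycle_apply, ContPairing.restrict_toLin, weilContPairing_toLin_apply, hκl2, hvadd,
      hvsub] at h
    have hl : (muVal K _ (weilPairingHom W (2 * (m * m)) P hP1 hPadd₁ hPadd₂ (κl.1 σ)
        (absGaloisRestrict K (Place.Completion v) σ • κl.1 τ)) : AlgebraicClosure K) =
        P (κl.1 σ) (absGaloisRestrict K (Place.Completion v) σ • κl.1 τ) := rfl
    have hρ : (muVal K _ ((TopRep.res (absGaloisRestrict K (Place.Completion v) :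
        absoluteGaloisGroup (Place.Completion v) →ₜ* absoluteGaloisGroup K) (mu K (2 * (m * m))).toTopRep).ρ σ (θ τ)) :
        AlgebraicClosure K) =
        absGaloisRestrict K (Place.Completion v) σ • (muVal K _ (θ τ) : AlgebraicClosure K) := hvmu _ _
    rw [hl, hρ] at h
    rw [h]
    have h4 := (muVal K _ (θ (σ * τ))).ne_zero
    field_simp
  -- the functions `ζ = η ∘ κ̃`, `u = ζ · θ` and the obstruction values `C`
  have hζ0 : ∀ σ, ((etaFn W m P (κl.1 σ) : (AlgebraicClosure K)ˣ) : AlgebraicClosure K) ≠ 0 := fun σ => Units.ne_zero _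
  set u : absoluteGaloisGroup (Place.Completion v) → AlgebraicClosure K :=
    fun σ => (etaFn W m P (κl.1 σ) : AlgebraicClosure K) * (muVal K _ (θ σ) : AlgebraicClosure K) with hu
  have hu0 : ∀ σ, u σ ≠ 0 := fun σ => mul_ne_zero (hζ0 σ) (Units.ne_zero _)
  have hκlc : IsLocallyConstant (fun σ => κl.1 σ) := (IsLocallyConstant.iff_continuous _).2 κl.1.continuous
  have hθc : IsLocallyConstant (fun σ => θ σ) := (IsLocallyConstant.iff_continuous _).2 θ.continuous
  have hulc : IsLocallyConstant u :=
    (hκlc.prodMk hθc).comp fun q => (etaFn W m P q.1 : AlgebraicClosure K) * (muVal K _ q.2 : AlgebraicClosure K)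
  set Θ := thetaEven W m P hP1 hPadd₁ hPadd₂ hPalt hPgal with hΘ
  set C : absoluteGaloisGroup (Place.Completion v) → absoluteGaloisGroup (Place.Completion v) → AlgebraicClosure K :=
    fun σ τ => (muVal K _ ((Θ.comap (absGaloisRestrict K (Place.Completion v) :
      absoluteGaloisGroup (Place.Completion v) →ₜ* absoluteGaloisGroup K).toMonoidHom).conn (fun σ => κl.1 σ) σ τ) :
        AlgebraicClosure K) with hCdef
  have hmuχ : ∀ (σ' : absoluteGaloisGroup K) (x : geomTorsion W ((2 * (m * m) : ℕ) : ℤ)),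
      (muVal K _ (Θ.χ σ' x) : AlgebraicClosure K) = σ' • (etaFn W m P x : AlgebraicClosure K) / etaFn W m P x := fun σ' x =>
    coe_twistMu_χ W (2 * (m * m)) P (pair_ne_zero W m P hP1) hPadd₁ hPadd₂ hPgal (etaFn W m P) (etaFn_zero W m P)
      (etaFn_smul W m P) (m * m) (twist_pow_eq_one W m P hP1 hPadd₁ hPadd₂ hPalt) (smul_etaFn_div_pow W m P) σ' x
  have hmum : ∀ x y : geomTorsion W ((2 * (m * m) : ℕ) : ℤ), (muVal K _ (Θ.m x y) : AlgebraicClosure K) =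
      (etaFn W m P x : AlgebraicClosure K) * etaFn W m P y / etaFn W m P (x + y) * P x y := fun x y =>
    coe_twistMu_m W (2 * (m * m)) P (pair_ne_zero W m P hP1) hPadd₁ hPadd₂ hPgal (etaFn W m P) (etaFn_zero W m P)
      (etaFn_smul W m P) (m * m) (twist_pow_eq_one W m P hP1 hPadd₁ hPadd₂ hPalt) (smul_etaFn_div_pow W m P) x y
  have hC : ∀ σ τ, C σ τ = (absGaloisRestrict K (Place.Completion v) σ • (etaFn W m P (κl.1 τ) : AlgebraicClosure K) /
        etaFn W m P (κl.1 τ)) *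
      ((etaFn W m P (κl.1 σ) : AlgebraicClosure K) * etaFn W m P (κl.1 τ) / etaFn W m P (κl.1 (σ * τ)) *
        P (κl.1 σ) (absGaloisRestrict K (Place.Completion v) σ • κl.1 τ)) := by
    intro σ τ
    have hres : ∀ σ, (absGaloisRestrict K (Place.Completion v) :
        absoluteGaloisGroup (Place.Completion v) →ₜ* absoluteGaloisGroup K).toMonoidHom σ =
        absGaloisRestrict K (Place.Completion v) σ := fun σ => rfl
    simp only [hCdef, HeisenbergDatum.conn_apply, HeisenbergDatum.comap_χ, HeisenbergDatum.comap_m,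
      HeisenbergDatum.comap_ρ_apply, hvadd, hres]
    rw [hmuχ, hmum, hΘ, thetaEven_ρ_apply, etaFn_smul, hκl3]
  have hI : ∀ σ τ, C σ τ * u (σ * τ) = u σ * absGaloisRestrict K (Place.Completion v) σ • u τ := by
    intro σ τ
    have hp : P (κl.1 σ) (absGaloisRestrict K (Place.Completion v) σ • κl.1 τ) =
        (muVal K _ (θ σ) : AlgebraicClosure K) * absGaloisRestrict K (Place.Completion v) σ •
          (muVal K _ (θ τ) : AlgebraicClosure K) / (muVal K _ (θ (σ * τ)) : AlgebraicClosure K) := by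
      rw [eq_div_iff (Units.ne_zero _)]
      exact hθval σ τ
    have h1 := hζ0 σ
    have h2 := hζ0 τ
    have h3 := hζ0 (σ * τ)
    have h4 := (muVal K _ (θ (σ * τ))).ne_zero
    simp only [hu]
    rw [hC, hp, smul_mul']
    field_simp
  have hcpow : ∀ σ τ, C σ τ ^ (m * m) = 1 := fun σ τ => hvpow _
  obtain ⟨b, hblc, hbpow, hb⟩ := exists_mu_coboundary_of_coboundary_res (Place.Completion v) hn u hu0 hulc C hI hcpow
  -- package `b` as a continuous `μ_{m²}`-valued cochain
  haveI : NeZero (m * m) := ⟨hn⟩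
  let g : AlgebraicClosure K → MuCarrier K (m * m) := fun z =>
    if hz : z ^ (m * m) = 1 then MuCarrier.ofRootsOfUnity (rootsOfUnity.mkOfPowEq z hz) else 0
  have hgb : ∀ σ, (muVal K _ (g (b σ)) : AlgebraicClosure K) = b σ := fun σ => by
    simp only [g, dif_pos (hbpow σ), muVal_ofRootsOfUnity, rootsOfUnity.val_mkOfPowEq_coe]
  have hgcont : Continuous fun σ => g (b σ) := (IsLocallyConstant.iff_continuous _).1 (hblc.comp g)
  refine ⟨⟨fun σ => g (b σ), hgcont⟩, fun σ τ => ?_⟩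
  apply muVal_injective K (m * m)
  apply Units.val_injective
  change C σ τ = _
  simp only
  rw [hvadd, hvsub]
  change C σ τ = (muVal K _ ((mu K (m * m)).toTopRep.ρ (absGaloisRestrict K (Place.Completion v) σ) (g (b τ))) :
      AlgebraicClosure K) / (muVal K _ (g (b (σ * τ))) : AlgebraicClosure K) * (muVal K _ (g (b σ)) : AlgebraicClosure K)
  have hρ : (muVal K _ ((mu K (m * m)).toTopRep.ρ (absGaloisRestrict K (Place.Completion v) σ) (g (b τ))) :
      AlgebraicClosure K) = absGaloisRestrict K (Place.Completion v) σ • (muVal K _ (g (b τ)) : AlgebraicClosure K) :=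
    hvmu _ _
  rw [hρ, hgb, hgb, hgb]
  have hb0 : b (σ * τ) ≠ 0 := fun h0 => by
    have := hbpow (σ * τ)
    rw [h0, zero_pow hn] at this
    exact zero_ne_one this
  rw [div_mul_eq_mul_div, eq_div_iff hb0, mul_comm (absGaloisRestrict K (Place.Completion v) σ • b τ) (b σ)]
  exact hb σ τ

end Iso

end Literature.NumberTheory.EllipticCurves

end
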